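import Summits.QuantumFields.BalabanUV.T4Continuum.Support.NE7EtaClosenessHolder
import HarnessLib

/-!
# NE7EtaHolderSocketBridges — route #1 of the NE7 crux (node U5), socket `h` AMENDMENT 5 (ROAD-G106 §3): two bridges INTO the Hölder conjunct
# (Höl½ᶜ) of the amended socket `h′` at the level of ONE pair `(W, Z)` — (a) from a CAPPED Hölder-½ letter (ranges `j ≤ L^k`, what a gauge-fixing
# theorem of [Balaban1985RegularSpaces] Thm 2 (1.36) TYPE delivers on cubes) together with (Lip₁ᶜ); (b) from the pointwise letter (P1) of the slice-free
# socket `hpt` (`NE7SocketHOfPointwiseLetters`) — so `h` (on ranges), `hpt` and the capped form all feed `h′`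

Cell `pub-balaban`, rung (B)+1 sub-cell t4, lineage `b2b-balaban-t4-ne7-p1`, generation 106 (CRUX PROVER NE7 #1 = OWNER of BINDER row NE7).
Memo `t4/b2b-balaban-t4-ne7-p1-g106/ROAD-G106.md` §3.
WHAT ([folklore]; 0 def, 0 sorry).  With `ξ = (L⁻¹)^k` (`L ≥ 1`), `W` unitary, `D(y) = Ad (W (y+e κ) μ) (Z (y+e μ) κ) − Z y κ` and the line holonomy
`H_j(y) = ∏_{i<j} W (y + e κ + i•e μ) μ`:
 * `norm_transportedDrift_le_two_mul` — (Lip₁ᶜ) `‖D‖ ≤ G` everywhere ⟹ `‖Ad (H_j(y)) (D(y + j•e μ)) − D(y)‖ ≤ 2G` (isometry + triangle inequality);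
 * **`holderHalf_uncapped_of_capped`** — capped Hölder `≤ Λ_H√j·ξ²√ξ` for `j ≤ L^k` and (Lip₁ᶜ) `‖D‖ ≤ Λ₁ξ²` ⟹ the UNCAPPED letter with constant
   `max Λ_H (2Λ₁)` (for `j > L^k`: `2Λ₁ξ² ≤ 2Λ₁·√j·ξ²·√ξ` because `j·ξ ≥ 1`);
 * **`holderHalf_of_pointwise`** — (P1) `‖D‖ ≤ p₁ξ³` (`p₁ ≥ 0`) ⟹ the uncapped letter with `Λ_H = 2p₁` (`ξ³ ≤ √j·ξ²√ξ` for `j ≥ 1`, `ξ ≤ 1`; `j = 0` is trivial).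
HONEST FRAMING (page 1): elementary inequalities; nothing of NE3∕NE7 discharged; nothing of Bałaban's asserted as an axiom; spine count = dagwriter∕referees'
call; FIXED FINITE T⁴, rung (B)+1 — NOT infinite volume, NOT mass gap, NOT BetaPertH, NOT Clay.
-/

set_option autoImplicit false

open scoped BigOperators Matrix Matrix.Norms.L2Operator
open Finset

namespace Summit.QuantumFields.BalabanUV.T4Continuum.NE7EtaHolderSocketBridges

open Literature.MathematicalPhysics.QuantumFieldTheory.Balaban1983to89
open B7Prop1Explicit B7Prop2Explicit
open T4AveragingDeficitWall hiding Site Plane Plaq Bond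
open AveragingDeficitTransport (norm_Ad_of_unitary)
open NE7EtaCovariantJunction (lineHol_mem_unitary)

noncomputable section

variable {d : ℕ} {n : Type*} [Fintype n] [DecidableEq n]

/-- **THE TRANSPORTED DRIFT IS AT MOST TWICE THE SUP OF THE COVARIANT GRADIENT** (`W` unitary). [folklore] -/
theorem norm_transportedDrift_le_two_mul {W : Site d → Fin d → (Matrix n n ℂ)ˣ} (hW : IsUnitaryCfg W) {Z : Site d → Fin d → Matrix n n ℂ}
    {G : ℝ} (hG : ∀ (κ : Fin d) (x : Site d) (μ : Fin d), ‖Ad (W (x + e κ) μ) (Z (x + e μ) κ) - Z x κ‖ ≤ G)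
    (κ μ : Fin d) (y : Site d) (j : ℕ) :
    ‖Ad (((List.range j).map fun i : ℕ => W (y + e κ + i • e μ) μ).prod)
          (Ad (W (y + j • e μ + e κ) μ) (Z (y + j • e μ + e μ) κ) - Z (y + j • e μ) κ)
        - (Ad (W (y + e κ) μ) (Z (y + e μ) κ) - Z y κ)‖ ≤ 2 * G := by
  have hu := lineHol_mem_unitary hW (y + e κ) μ j
  have h1 : ‖Ad (((List.range j).map fun i : ℕ => W (y + e κ + i • e μ) μ).prod)
      (Ad (W (y + j • e μ + e κ) μ) (Z (y + j • e μ + e μ) κ) - Z (y + j • e μ) κ)‖ ≤ G := by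
    rw [norm_Ad_of_unitary hu]; exact hG κ (y + j • e μ) μ
  have h2 := hG κ y μ
  exact (norm_sub_le _ _).trans (by linarith)

/-- **UNCAPPED HÖLDER-½ FROM CAPPED HÖLDER-½ AND (Lip₁ᶜ)** (`L ≥ 1`, `W` unitary, `ξ = (L⁻¹)^k`): statement in the module docstring. [folklore] -/
theorem holderHalf_uncapped_of_capped {L : ℕ} (hL : 1 ≤ L) (k : ℕ) {W : Site d → Fin d → (Matrix n n ℂ)ˣ} (hW : IsUnitaryCfg W)
    {Z : Site d → Fin d → Matrix n n ℂ} {Λ₁ ΛH : ℝ} (hΛ₁ : 0 ≤ Λ₁)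
    (hlipc : ∀ (κ : Fin d) (x : Site d) (μ : Fin d), ‖Ad (W (x + e κ) μ) (Z (x + e μ) κ) - Z x κ‖ ≤ Λ₁ * (((L : ℝ)⁻¹) ^ k) ^ 2)
    (hcap : ∀ (κ μ : Fin d) (y : Site d) (j : ℕ), j ≤ L ^ k →
      ‖Ad (((List.range j).map fun i : ℕ => W (y + e κ + i • e μ) μ).prod)
            (Ad (W (y + j • e μ + e κ) μ) (Z (y + j • e μ + e μ) κ) - Z (y + j • e μ) κ)
          - (Ad (W (y + e κ) μ) (Z (y + e μ) κ) - Z y κ)‖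
        ≤ ΛH * Real.sqrt (j : ℝ) * (((L : ℝ)⁻¹) ^ k) ^ 2 * Real.sqrt (((L : ℝ)⁻¹) ^ k))
    (κ μ : Fin d) (y : Site d) (j : ℕ) :
    ‖Ad (((List.range j).map fun i : ℕ => W (y + e κ + i • e μ) μ).prod)
          (Ad (W (y + j • e μ + e κ) μ) (Z (y + j • e μ + e μ) κ) - Z (y + j • e μ) κ)
        - (Ad (W (y + e κ) μ) (Z (y + e μ) κ) - Z y κ)‖
      ≤ max ΛH (2 * Λ₁) * Real.sqrt (j : ℝ) * (((L : ℝ)⁻¹) ^ k) ^ 2 * Real.sqrt (((L : ℝ)⁻¹) ^ k) := by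
  set ξ : ℝ := ((L : ℝ)⁻¹) ^ k with hξ
  have hL0 : (0 : ℝ) < L := by exact_mod_cast (by omega : 0 < L)
  have hξ0 : 0 < ξ := by rw [hξ]; positivity
  have hbase : 0 ≤ Real.sqrt (j : ℝ) * ξ ^ 2 * Real.sqrt ξ := by positivity
  by_cases hj : j ≤ L ^ k
  · calc _ ≤ ΛH * Real.sqrt (j : ℝ) * ξ ^ 2 * Real.sqrt ξ := hcap κ μ y j hj
      _ = ΛH * (Real.sqrt (j : ℝ) * ξ ^ 2 * Real.sqrt ξ) := by ring
      _ ≤ max ΛH (2 * Λ₁) * (Real.sqrt (j : ℝ) * ξ ^ 2 * Real.sqrt ξ) := mul_le_mul_of_nonneg_right (le_max_left _ _) hbase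
      _ = _ := by ring
  · push Not at hj
    -- `j·ξ ≥ 1`, hence `√j·√ξ ≥ 1`
    have hLk : ((L : ℝ) ^ k) * ξ = 1 := by
      rw [hξ, inv_pow, mul_inv_cancel₀ (pow_ne_zero _ hL0.ne')]
    have hjξ : 1 ≤ (j : ℝ) * ξ := by
      have hjr : ((L : ℝ) ^ k) ≤ (j : ℝ) := by exact_mod_cast hj.le
      calc (1 : ℝ) = ((L : ℝ) ^ k) * ξ := hLk.symm
        _ ≤ (j : ℝ) * ξ := mul_le_mul_of_nonneg_right hjr hξ0.le
    have hs1 : 1 ≤ Real.sqrt (j : ℝ) * Real.sqrt ξ := by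
      rw [← Real.sqrt_mul (by positivity : (0 : ℝ) ≤ j), ← Real.sqrt_one]
      exact Real.sqrt_le_sqrt hjξ
    have h2 := norm_transportedDrift_le_two_mul hW hlipc κ μ y j
    have hstep : 2 * (Λ₁ * ξ ^ 2) ≤ 2 * Λ₁ * Real.sqrt (j : ℝ) * ξ ^ 2 * Real.sqrt ξ := by
      have h0 : 0 ≤ 2 * Λ₁ * ξ ^ 2 := by positivity
      calc 2 * (Λ₁ * ξ ^ 2) = (2 * Λ₁ * ξ ^ 2) * 1 := by ring
        _ ≤ (2 * Λ₁ * ξ ^ 2) * (Real.sqrt (j : ℝ) * Real.sqrt ξ) := mul_le_mul_of_nonneg_left hs1 h0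
        _ = 2 * Λ₁ * Real.sqrt (j : ℝ) * ξ ^ 2 * Real.sqrt ξ := by ring
    calc _ ≤ 2 * (Λ₁ * ξ ^ 2) := h2
      _ ≤ 2 * Λ₁ * Real.sqrt (j : ℝ) * ξ ^ 2 * Real.sqrt ξ := hstep
      _ = (2 * Λ₁) * (Real.sqrt (j : ℝ) * ξ ^ 2 * Real.sqrt ξ) := by ring
      _ ≤ max ΛH (2 * Λ₁) * (Real.sqrt (j : ℝ) * ξ ^ 2 * Real.sqrt ξ) := mul_le_mul_of_nonneg_right (le_max_right _ _) hbase
      _ = _ := by ring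

/-- **HÖLDER-½ FROM THE POINTWISE LETTER (P1)** (`L ≥ 1`, `W` unitary): (P1) `‖D‖ ≤ p₁ξ³` everywhere (`p₁ ≥ 0`) ⟹ the uncapped transported Hölder-½
letter with constant `2p₁`. [folklore] -/
theorem holderHalf_of_pointwise {L : ℕ} (hL : 1 ≤ L) (k : ℕ) {W : Site d → Fin d → (Matrix n n ℂ)ˣ} (hW : IsUnitaryCfg W)
    {Z : Site d → Fin d → Matrix n n ℂ} {p₁ : ℝ} (hp₁ : 0 ≤ p₁)
    (hP1 : ∀ (κ : Fin d) (x : Site d) (μ : Fin d), ‖Ad (W (x + e κ) μ) (Z (x + e μ) κ) - Z x κ‖ ≤ p₁ * (((L : ℝ)⁻¹) ^ k) ^ 3)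
    (κ μ : Fin d) (y : Site d) (j : ℕ) :
    ‖Ad (((List.range j).map fun i : ℕ => W (y + e κ + i • e μ) μ).prod)
          (Ad (W (y + j • e μ + e κ) μ) (Z (y + j • e μ + e μ) κ) - Z (y + j • e μ) κ)
        - (Ad (W (y + e κ) μ) (Z (y + e μ) κ) - Z y κ)‖
      ≤ 2 * p₁ * Real.sqrt (j : ℝ) * (((L : ℝ)⁻¹) ^ k) ^ 2 * Real.sqrt (((L : ℝ)⁻¹) ^ k) := by
  set ξ : ℝ := ((L : ℝ)⁻¹) ^ k with hξ
  have hL1 : (1 : ℝ) ≤ L := by exact_mod_cast hL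
  have hξ0 : 0 ≤ ξ := by rw [hξ]; positivity
  have hξ1 : ξ ≤ 1 := by rw [hξ]; exact pow_le_one₀ (by positivity) (inv_le_one_of_one_le₀ hL1)
  rcases Nat.eq_zero_or_pos j with hj | hj
  · -- `j = 0`: the drift vanishes
    subst hj
    have e0 : ((List.range 0).map fun i : ℕ => W (y + e κ + i • e μ) μ).prod = 1 := by simp
    rw [e0, AveragingDeficitNearIdentity.Ad_one, zero_nsmul, add_zero, sub_self, norm_zero]
    positivity
  · have h2 := norm_transportedDrift_le_two_mul hW hP1 κ μ y j
    -- `ξ³ = ξ²·√ξ·√ξ ≤ ξ²·√ξ·√j`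
    have hsξ : Real.sqrt ξ * Real.sqrt ξ = ξ := Real.mul_self_sqrt hξ0
    have hsξ1 : Real.sqrt ξ ≤ 1 := by rw [← Real.sqrt_one]; exact Real.sqrt_le_sqrt hξ1
    have hsj1 : 1 ≤ Real.sqrt (j : ℝ) := by
      rw [← Real.sqrt_one]; exact Real.sqrt_le_sqrt (by exact_mod_cast hj)
    have h0 : 0 ≤ Real.sqrt ξ := Real.sqrt_nonneg _
    have hkey : ξ ^ 3 ≤ Real.sqrt (j : ℝ) * ξ ^ 2 * Real.sqrt ξ := by
      have e : ξ ^ 3 = ξ ^ 2 * Real.sqrt ξ * Real.sqrt ξ := by rw [mul_assoc, hsξ]; ring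
      rw [e]
      have h1 : ξ ^ 2 * Real.sqrt ξ * Real.sqrt ξ ≤ ξ ^ 2 * Real.sqrt ξ * 1 :=
        mul_le_mul_of_nonneg_left hsξ1 (by positivity)
      have h3 : ξ ^ 2 * Real.sqrt ξ * 1 ≤ ξ ^ 2 * Real.sqrt ξ * Real.sqrt (j : ℝ) :=
        mul_le_mul_of_nonneg_left hsj1 (by positivity)
      linarith
    calc _ ≤ 2 * (p₁ * ξ ^ 3) := h2
      _ ≤ 2 * (p₁ * (Real.sqrt (j : ℝ) * ξ ^ 2 * Real.sqrt ξ)) := by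
          have := mul_le_mul_of_nonneg_left hkey hp₁
          linarith
      _ = 2 * p₁ * Real.sqrt (j : ℝ) * ξ ^ 2 * Real.sqrt ξ := by ring

end

end Summit.QuantumFields.BalabanUV.T4Continuum.NE7EtaHolderSocketBridges
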